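import Summits.Ventures.PercRepro.C025ProfileGirthHallSuccB2
import Summits.Ventures.PercRepro.C025ProfileGirthHallSuccC2
import Summits.Ventures.PercRepro.C025ProfileGirthHallSuccD
import Summits.Ventures.PercRepro.C025ProfileGirthHall

/-!
# THE HALL FORM OF THE ROW `(q, q+1)` AT GIRTH `≥ q + 1` — PART E: EVERY RANK (night-3 g19)

Part D proved `(H⁺_{q,q+1})` (C-033 at `(q, q+1)`) at girth `≥ q + 1` for every rank `≠ q + 1`.  The missing rank
`ρ(E) = q + 1` splits in two:
* some rank-`q` set `B₀` has at most one point outside its closure — then that point `y` is a coloop (`E ∖ y ⊆ cl B₀`),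
  every priced member `B` of a family avoids `y` and `cl B`, so `B ↦ B ∪ {y}` injects the priced members into the
  shadow, and every price is `C(2q+1, q+1)/C(2q+1, q) = 1` (**`hallIneq_succ_of_one_out`**; no girth needed);
* otherwise every rank-`q` set has `m_B ≥ 2`, which is all the certificate of parts B–C used the rank for
  (**`hallIneq_succ_of_girth_out`** = part D's proof on `cap_of_weights_out` / `dem_of_weights_out`).
**`hallIneq_succ_of_girth`** `(hq : 2 ≤ q) (hg : ∀ T ⊆ M.E, T.encard ≤ q → M.Indep T) : Profile.HallIneq M q (q + 1)` —
C-033 at `(q, q+1)` on EVERY finite matroid in which every set of at most `q` points is independent, `q ≥ 2`; with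
`hallIneq_of_girth_succ` (the rows `q ≤ u − 2` at girth `≥ u`): **`hallIneq_of_girth_every`** — C-033 at every row
`(q, u)`, `2 ≤ q < u`, on every finite matroid of girth `≥ u`; and the same for the rows of `(Π)` (C-032),
`profileIneq_of_girth_every`, `profileIneq_and_hallIneq_of_girth_every`.
No `def`, no `instance`, no notation.  Axioms: standard.
-/

open scoped Matroid

namespace PercRepro

open Set Finset ThmH Staged

namespace GirthRows

variable {α : Type} [DecidableEq α] {M : Matroid α} [M.Finite]

open scoped Classical

/-- **The Hall form at `ρ(E) = q + 1` when some rank-`q` set has at most one point outside its closure.**  That point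
`y` lies outside `cl B₀` while every other point of `E` lies inside (so `y` is a coloop); a member `B` with nonzero
price has `ρ(E ∖ B) = q + 1`, hence `y ∉ B` (else `E ∖ B ⊆ cl B₀`) and `y ∉ cl B` (as `B ⊆ cl B₀`), so `B ∪ {y}` is a
rank-`(q+1)` set containing `B`; `B ↦ B ∪ {y}` is injective and every such price is `C(2q+1, q+1)/C(2q+1, q) = 1`. -/
theorem hallIneq_succ_of_one_out {q : ℕ} (hE : M.eRank = ((q + 1 : ℕ) : ℕ∞)) {B₀ : Finset α}
    (hB₀ : B₀ ∈ Profile.Rq M q) (h1 : ((gr M).filter (fun x => x ∉ M.closure (B₀ : Set α))).card ≤ 1) :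
    Profile.HallIneq M q (q + 1) := by
  intro 𝒜 h𝒜
  obtain ⟨_, hB₀r⟩ := Profile.mem_Rq.1 hB₀
  have hB₀r' : rkN M B₀ = q := Staged.rkN_eq_iff.2 hB₀r
  -- the point outside the closure of `B₀`
  obtain ⟨y, hyg, hyc⟩ := exists_notMem_closure_of_rkN_eq hB₀r' (by rw [hE])
  have hyO : y ∈ (gr M).filter (fun x => x ∉ M.closure (B₀ : Set α)) := Finset.mem_filter.2 ⟨hyg, hyc⟩
  have hyE : y ∈ M.E := by rw [← coe_gr M]; exact Finset.mem_coe.2 hyg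
  -- every other point of `E` lies in `cl B₀`
  have hall : ∀ x ∈ gr M, x ≠ y → x ∈ M.closure (B₀ : Set α) := by
    intro x hx hxy
    by_contra hxc
    have hxO : x ∈ (gr M).filter (fun x => x ∉ M.closure (B₀ : Set α)) := Finset.mem_filter.2 ⟨hx, hxc⟩
    have hsub : ({x, y} : Finset α) ⊆ (gr M).filter (fun x => x ∉ M.closure (B₀ : Set α)) := by
      intro z hz
      rw [Finset.mem_insert, Finset.mem_singleton] at hz
      rcases hz with rfl | rfl
      · exact hxO
      · exact hyO
    have h2 := Finset.card_le_card hsub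
    rw [Finset.card_pair hxy] at h2
    omega
  -- the priced members
  set 𝒜' := 𝒜.filter (fun B => Profile.price M q (q + 1) B ≠ 0) with h𝒜'
  have hfacts : ∀ B ∈ 𝒜', y ∉ B ∧ y ∉ M.closure (B : Set α) ∧ Profile.price M q (q + 1) B = 1 := by
    intro B hB
    rw [h𝒜', Finset.mem_filter] at hB
    obtain ⟨hB𝒜, hBne⟩ := hB
    obtain ⟨hBg, _⟩ := Profile.mem_Rq.1 (h𝒜 hB𝒜)
    -- the threshold holds
    have hthr : ((q + 1 : ℕ) : ℕ∞) ≤ M.eRk ((gr M \ B : Finset α) : Set α) := by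
      by_contra hc
      apply hBne
      unfold Profile.price
      rw [if_neg hc]
    have hyB : y ∉ B := by
      intro hyB
      have hsub : ((gr M \ B : Finset α) : Set α) ⊆ M.closure (B₀ : Set α) := by
        intro x hx
        rw [Finset.mem_coe, Finset.mem_sdiff] at hx
        exact hall x hx.1 (fun h => hx.2 (h ▸ hyB))
      have hle : M.eRk ((gr M \ B : Finset α) : Set α) ≤ (q : ℕ∞) := by
        calc M.eRk ((gr M \ B : Finset α) : Set α) ≤ M.eRk (M.closure (B₀ : Set α)) := M.eRk_mono hsub
          _ = M.eRk (B₀ : Set α) := M.eRk_closure_eq _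
          _ = q := hB₀r
      have h2 := hthr.trans hle
      have h3 : q + 1 ≤ q := by exact_mod_cast h2
      omega
    have hyc' : y ∉ M.closure (B : Set α) := by
      intro hyc'
      have hsub : (B : Set α) ⊆ M.closure (B₀ : Set α) := by
        intro x hx
        rw [Finset.mem_coe] at hx
        exact hall x (hBg hx) (fun h => hyB (h ▸ hx))
      have hcl : M.closure (B : Set α) ⊆ M.closure (B₀ : Set α) := by
        calc M.closure (B : Set α) ⊆ M.closure (M.closure (B₀ : Set α)) := M.closure_subset_closure hsub
          _ = M.closure (B₀ : Set α) := M.closure_closure _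
      exact hyc (hcl hyc')
    refine ⟨hyB, hyc', ?_⟩
    -- the price is `1`
    have hle : M.eRk ((gr M \ B : Finset α) : Set α) ≤ ((q + 1 : ℕ) : ℕ∞) := hE ▸ M.eRk_le_eRank _
    have heq : M.eRk ((gr M \ B : Finset α) : Set α) = ((q + 1 : ℕ) : ℕ∞) := le_antisymm hle hthr
    unfold Profile.price
    rw [if_pos hthr, heq, ENat.toNat_coe]
    have hpos : (0 : ℚ) < (Nat.choose (q + 1 + q) q : ℚ) := by
      exact_mod_cast Nat.choose_pos (by omega)
    rw [Nat.choose_symm_add (a := q + 1) (b := q)]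
    exact div_self hpos.ne'
  -- the sum of prices is the number of priced members
  have hsum : ∑ B ∈ 𝒜, Profile.price M q (q + 1) B = ∑ B ∈ 𝒜', Profile.price M q (q + 1) B :=
    (Finset.sum_filter_ne_zero _).symm
  have hone : ∑ B ∈ 𝒜', Profile.price M q (q + 1) B = (𝒜'.card : ℚ) := by
    rw [Finset.card_eq_sum_ones, Nat.cast_sum]
    apply Finset.sum_congr rfl
    intro B hB
    rw [(hfacts B hB).2.2]
    simp
  rw [hsum, hone]
  -- the injection `B ↦ B ∪ {y}` into the shadow
  have hcard : 𝒜'.card ≤ (Shadow.shadowLevel M (q + 1) 𝒜).card := by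
    apply Finset.card_le_card_of_injOn (fun B => insert y B)
    · intro B hB
      rw [Finset.mem_coe] at hB
      obtain ⟨_, hyc', _⟩ := hfacts B hB
      have hB𝒜 : B ∈ 𝒜 := (Finset.mem_filter.1 hB).1
      obtain ⟨hBg, hBr⟩ := Profile.mem_Rq.1 (h𝒜 hB𝒜)
      rw [Finset.mem_coe, mem_shadowLevel]
      refine ⟨?_, B, hB𝒜, Finset.subset_insert y B⟩
      rw [Profile.mem_levelSet]
      refine ⟨Finset.insert_subset hyg hBg, ?_⟩
      rw [Finset.coe_insert, Matroid.eRk_insert_eq_add_one ⟨hyE, hyc'⟩, hBr]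
      push_cast
      rfl
    · intro B hB B' hB' heq
      rw [Finset.mem_coe] at hB hB'
      obtain ⟨hyB, _, _⟩ := hfacts B hB
      obtain ⟨hyB', _, _⟩ := hfacts B' hB'
      have h1 : B = (insert y B).erase y := (Finset.erase_insert hyB).symm
      have h2 : B' = (insert y B').erase y := (Finset.erase_insert hyB').symm
      rw [h1, h2]
      simp only at heq
      rw [heq]
  exact_mod_cast hcard

/-- **The Hall form `(H⁺_{q,q+1})` at girth `≥ q + 1` when every rank-`q` set has at least two points outside its closure**
(`q ≥ 2`): part D's weights on `cap_of_weights_out` / `dem_of_weights_out`. -/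
theorem hallIneq_succ_of_girth_out {q : ℕ} (hq : 2 ≤ q) (hg : ∀ T ⊆ M.E, T.encard ≤ q → M.Indep T)
    (hout : ∀ B ∈ Profile.Rq M q, 2 ≤ ((gr M).filter (fun x => x ∉ M.closure (B : Set α))).card) :
    Profile.HallIneq M q (q + 1) := by
  -- the weights
  set t : Finset α → ℚ := fun B => 1 / (2 * ((q : ℚ) + 1) *
    ((((gr M).filter (fun x => x ∈ M.closure (B : Set α))).card - q - 1 : ℕ) : ℚ)) with ht_def
  set wgt : Finset α → ℚ := fun B =>
    if B.card = q + 1 then 1 - 1 / (((gr M).filter (fun x => x ∉ M.closure (B : Set α))).card : ℚ)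
    else if B.card = q + 2 ∧ ((gr M).filter (fun x => x ∉ M.closure (B : Set α))).card = 2 ∧
        2 * q + 1 ≤ ((gr M).filter (fun x => x ∈ M.closure (B : Set α))).card then 1 - ((q : ℚ) + 2) * t B
    else 1 with hwgt_def
  set W : Finset α → Finset α → ℚ := fun B S =>
    if B ⊆ S ∧ B.card = q ∧ S.card = q + 1 then 1 / ((q : ℚ) + 1)
    else if B ⊆ S ∧ B.card = q ∧ S.card = q + 2 ∧ ((S \ B).filter (fun x => x ∈ M.closure (B : Set α))).card = 1 then
      1 / (((q : ℚ) + 1) * (((gr M).filter (fun x => x ∉ M.closure (B : Set α))).card : ℚ))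
    else if B ⊆ S ∧ q + 1 ≤ B.card ∧ S.card = B.card + 1 ∧
        ((S \ B).filter (fun x => x ∈ M.closure (B : Set α))).card = 0 then wgt B
    else if B ⊆ S ∧ B.card = q + 1 ∧ ((gr M).filter (fun x => x ∉ M.closure (B : Set α))).card = 2 ∧
        2 * q + 1 ≤ ((gr M).filter (fun x => x ∈ M.closure (B : Set α))).card ∧ S.card = q + 3 ∧
        ((S \ B).filter (fun x => x ∈ M.closure (B : Set α))).card = 1 then t B
    else 0 with hW_def
  -- the facts about t and wgt
  have ht : ∀ B : Finset α, t B = 1 / (2 * ((q : ℚ) + 1) *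
      ((((gr M).filter (fun x => x ∈ M.closure (B : Set α))).card - q - 1 : ℕ) : ℚ)) := fun B => rfl
  have htnn : ∀ B, 0 ≤ t B := by
    intro B; rw [ht B]; positivity
  have hw1 : ∀ B : Finset α, B.card = q + 1 →
      wgt B = 1 - 1 / (((gr M).filter (fun x => x ∉ M.closure (B : Set α))).card : ℚ) := by
    intro B hB
    rw [hwgt_def]; dsimp only
    rw [if_pos hB]
  have hw2 : ∀ B : Finset α, B.card = q + 2 → ((gr M).filter (fun x => x ∉ M.closure (B : Set α))).card = 2 →
      2 * q + 1 ≤ ((gr M).filter (fun x => x ∈ M.closure (B : Set α))).card → wgt B = 1 - ((q : ℚ) + 2) * t B := by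
    intro B hB hm hN
    rw [hwgt_def]; dsimp only
    rw [if_neg (by omega), if_pos ⟨hB, hm, hN⟩]
  have hw3 : ∀ B : Finset α, B.card = q + 2 → ¬ (((gr M).filter (fun x => x ∉ M.closure (B : Set α))).card = 2 ∧
      2 * q + 1 ≤ ((gr M).filter (fun x => x ∈ M.closure (B : Set α))).card) → wgt B = 1 := by
    intro B hB hc
    rw [hwgt_def]; dsimp only
    rw [if_neg (by omega), if_neg (fun h => hc h.2)]
  have hw5 : ∀ B : Finset α, q + 3 ≤ B.card → wgt B = 1 := by
    intro B hB
    rw [hwgt_def]; dsimp only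
    rw [if_neg (by omega), if_neg (fun h => by omega)]
  have hw4 : ∀ B : Finset α, wgt B ≤ 1 := by
    intro B
    rw [hwgt_def]; dsimp only
    split_ifs with h1 h2
    · have : (0 : ℚ) ≤ 1 / (((gr M).filter (fun x => x ∉ M.closure (B : Set α))).card : ℚ) := by positivity
      linarith
    · have := htnn B
      have hq' : (0 : ℚ) ≤ (q : ℚ) + 2 := by positivity
      nlinarith
    · exact le_refl 1
  have hwnn : ∀ B : Finset α, 0 ≤ wgt B := by
    intro B
    rw [hwgt_def]; dsimp only
    split_ifs with h1 h2
    · have hm : 2 ≤ ((gr M).filter (fun x => x ∉ M.closure (B : Set α))).card ∨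
          ((gr M).filter (fun x => x ∉ M.closure (B : Set α))).card < 2 := by omega
      rcases hm with hm | hm
      · have : (2 : ℚ) ≤ (((gr M).filter (fun x => x ∉ M.closure (B : Set α))).card : ℚ) := by exact_mod_cast hm
        have : 1 / (((gr M).filter (fun x => x ∉ M.closure (B : Set α))).card : ℚ) ≤ 1 / 2 := by
          apply div_le_div_of_nonneg_left (by norm_num) (by norm_num) this
        linarith
      · -- fewer than two points outside: only happens for non-rank-q sets; bound crudely via the cast
        rcases Nat.lt_or_ge ((gr M).filter (fun x => x ∉ M.closure (B : Set α))).card 1 with h0 | h1'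
        · have : ((gr M).filter (fun x => x ∉ M.closure (B : Set α))).card = 0 := by omega
          rw [this]; norm_num
        · have : ((gr M).filter (fun x => x ∉ M.closure (B : Set α))).card = 1 := by omega
          rw [this]; norm_num
    · rw [ht B]
      have hN : (q : ℚ) + 2 ≤ ((((gr M).filter (fun x => x ∈ M.closure (B : Set α))).card - q - 1 : ℕ) : ℚ) * q := by
        have h3 : q ≤ ((gr M).filter (fun x => x ∈ M.closure (B : Set α))).card - q - 1 := by omega
        have : q + 2 ≤ (((gr M).filter (fun x => x ∈ M.closure (B : Set α))).card - q - 1) * q := by nlinarith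
        exact_mod_cast this
      have hDpos : (0 : ℚ) < ((((gr M).filter (fun x => x ∈ M.closure (B : Set α))).card - q - 1 : ℕ) : ℚ) := by
        exact_mod_cast (by omega : 0 < ((gr M).filter (fun x => x ∈ M.closure (B : Set α))).card - q - 1)
      set D : ℚ := ((((gr M).filter (fun x => x ∈ M.closure (B : Set α))).card - q - 1 : ℕ) : ℚ) with hD
      have hq' : (0 : ℚ) < (q : ℚ) + 1 := by positivity
      have : ((q : ℚ) + 2) * (1 / (2 * ((q : ℚ) + 1) * D)) ≤ 1 := by
        rw [mul_one_div, div_le_one (by positivity)]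
        nlinarith
      linarith
    · exact zero_le_one
  -- the facts about W
  have hnn : ∀ B S, 0 ≤ W B S := by
    intro B S
    rw [hW_def]; dsimp only
    split_ifs
    · positivity
    · positivity
    · exact hwnn B
    · exact htnn B
    · exact le_refl 0
  have h1 : ∀ B S : Finset α, B ⊆ S → B.card = q → S.card = q + 1 → W B S = 1 / ((q : ℚ) + 1) := by
    intro B S hBS hB hS
    rw [hW_def]; dsimp only
    rw [if_pos ⟨hBS, hB, hS⟩]
  have h2 : ∀ B S : Finset α, B ⊆ S → B.card = q → S.card = q + 2 →
      ((S \ B).filter (fun x => x ∈ M.closure (B : Set α))).card = 1 →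
      W B S = 1 / (((q : ℚ) + 1) * (((gr M).filter (fun x => x ∉ M.closure (B : Set α))).card : ℚ)) := by
    intro B S hBS hB hS hc
    rw [hW_def]; dsimp only
    rw [if_neg (fun h => by omega), if_pos ⟨hBS, hB, hS, hc⟩]
  have h3 : ∀ B S : Finset α, B ⊆ S → q + 1 ≤ B.card → S.card = B.card + 1 →
      ((S \ B).filter (fun x => x ∈ M.closure (B : Set α))).card = 0 → W B S = wgt B := by
    intro B S hBS hB hS hc
    rw [hW_def]; dsimp only
    rw [if_neg (fun h => by omega), if_neg (fun h => by omega), if_pos ⟨hBS, hB, hS, hc⟩]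
  have h4 : ∀ B S : Finset α, B ⊆ S → B.card = q + 1 →
      ((gr M).filter (fun x => x ∉ M.closure (B : Set α))).card = 2 →
      2 * q + 1 ≤ ((gr M).filter (fun x => x ∈ M.closure (B : Set α))).card → S.card = q + 3 →
      ((S \ B).filter (fun x => x ∈ M.closure (B : Set α))).card = 1 → W B S = t B := by
    intro B S hBS hB hm hN hS hc
    rw [hW_def]; dsimp only
    rw [if_neg (fun h => by omega), if_neg (fun h => by omega), if_neg (fun h => by omega),
      if_pos ⟨hBS, hB, hm, hN, hS, hc⟩]
  have h0 : ∀ B S : Finset α,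
      ¬ (B ⊆ S ∧ B.card = q ∧ S.card = q + 1) →
      ¬ (B ⊆ S ∧ B.card = q ∧ S.card = q + 2 ∧ ((S \ B).filter (fun x => x ∈ M.closure (B : Set α))).card = 1) →
      ¬ (B ⊆ S ∧ q + 1 ≤ B.card ∧ S.card = B.card + 1 ∧
          ((S \ B).filter (fun x => x ∈ M.closure (B : Set α))).card = 0) →
      ¬ (B ⊆ S ∧ B.card = q + 1 ∧ ((gr M).filter (fun x => x ∉ M.closure (B : Set α))).card = 2 ∧
          2 * q + 1 ≤ ((gr M).filter (fun x => x ∈ M.closure (B : Set α))).card ∧ S.card = q + 3 ∧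
          ((S \ B).filter (fun x => x ∈ M.closure (B : Set α))).card = 1) → W B S = 0 := by
    intro B S c1 c2 c3 c4
    rw [hW_def]; dsimp only
    rw [if_neg c1, if_neg c2, if_neg c3, if_neg c4]
  exact hallIneq_of_cert q (q + 1) W hnn (cap_of_weights_out hg hout W wgt t hw1 hw2 hw3 hw4 ht h1 h2 h3 h4 h0)
    (dem_of_weights_out hq hout W wgt t hnn hw1 hw2 hw3 hw5 ht h1 h2 h3 h4)

/-- **THE HALL FORM `(H⁺_{q,q+1})` AT GIRTH `≥ q + 1`, EVERY RANK** (`q ≥ 2`): for every family `𝒜` of rank-`q` sets of a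
finite matroid in which every set of at most `q` points is independent, `Σ_{B ∈ 𝒜} price(B) ≤ #{S : ρ(S) = q + 1, S ⊇ some
B ∈ 𝒜}` — rank `≠ q + 1` by part D; rank `q + 1` by the coloop injection or by the certificate with `m_B ≥ 2`. -/
theorem hallIneq_succ_of_girth {q : ℕ} (hq : 2 ≤ q) (hg : ∀ T ⊆ M.E, T.encard ≤ q → M.Indep T) :
    Profile.HallIneq M q (q + 1) := by
  by_cases hne : M.eRank ≠ ((q + 1 : ℕ) : ℕ∞)
  · exact hallIneq_succ_of_girth_of_ne hq hg hne
  · have hE : M.eRank = ((q + 1 : ℕ) : ℕ∞) := not_ne_iff.1 hne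
    by_cases h : ∃ B ∈ Profile.Rq M q, ((gr M).filter (fun x => x ∉ M.closure (B : Set α))).card ≤ 1
    · obtain ⟨B₀, hB₀, h1⟩ := h
      exact hallIneq_succ_of_one_out hE hB₀ h1
    · have hout : ∀ B ∈ Profile.Rq M q, 2 ≤ ((gr M).filter (fun x => x ∉ M.closure (B : Set α))).card := by
        intro B hB
        by_contra hc
        exact h ⟨B, hB, by omega⟩
      exact hallIneq_succ_of_girth_out hq hg hout

/-- C-033 at every row `(q, u)`, `2 ≤ q < u`, on every finite matroid of girth `≥ u` (every set of at most `u − 1`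
points independent): `q ≤ u − 2` is `hallIneq_of_girth_succ`, `q = u − 1` is `hallIneq_succ_of_girth`. -/
theorem hallIneq_of_girth_every (q u : ℕ) (hq : 2 ≤ q) (hqu : q < u)
    (hg : ∀ T ⊆ M.E, T.encard + 1 ≤ u → M.Indep T) : Profile.HallIneq M q u := by
  obtain ⟨v, rfl⟩ : ∃ v, u = v + 1 := ⟨u - 1, by omega⟩
  have hg' : ∀ T ⊆ M.E, T.encard ≤ v → M.Indep T := by
    intro T hT hTv
    apply hg T hT
    rw [Nat.cast_succ]
    gcongr
  rcases Nat.lt_or_ge q v with hlt | hge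
  · exact hallIneq_of_girth_succ hg' hlt
  · have hqv : q = v := by omega
    subst hqv
    exact hallIneq_succ_of_girth hq hg'

/-- C-032 (the row `(q, u)` of `(Π)`) at every row `2 ≤ q < u` on every finite matroid of girth `≥ u`:
`q ≤ u − 2` is `profileIneq_of_girth_succ`, `q = u − 1` is `profileIneq_succ_of_girth`. -/
theorem profileIneq_of_girth_every (q u : ℕ) (hq : 2 ≤ q) (hqu : q < u)
    (hg : ∀ T ⊆ M.E, T.encard + 1 ≤ u → M.Indep T) : Profile.ProfileIneq M q u := by
  obtain ⟨v, rfl⟩ : ∃ v, u = v + 1 := ⟨u - 1, by omega⟩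
  have hg' : ∀ T ⊆ M.E, T.encard ≤ v → M.Indep T := by
    intro T hT hTv
    apply hg T hT
    rw [Nat.cast_succ]
    gcongr
  rcases Nat.lt_or_ge q v with hlt | hge
  · exact profileIneq_of_girth_succ hg' hlt
  · have hqv : q = v := by omega
    subst hqv
    exact profileIneq_succ_of_girth hq hg'

/-- The row `(q, u)` of `(Π)` and its Hall form together, `2 ≤ q < u`, at girth `≥ u`. -/
theorem profileIneq_and_hallIneq_of_girth_every (q u : ℕ) (hq : 2 ≤ q) (hqu : q < u)
    (hg : ∀ T ⊆ M.E, T.encard + 1 ≤ u → M.Indep T) :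
    Profile.ProfileIneq M q u ∧ Profile.HallIneq M q u :=
  ⟨profileIneq_of_girth_every q u hq hqu hg, hallIneq_of_girth_every q u hq hqu hg⟩

end GirthRows

end PercRepro
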